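/-
Copyright (c) 2026 the pub-hodgecm-mathlib formalisation cell (harness21).  Prover seat hodgecm-mathlib-K2E3-p24 (g2), HCML Track B «K2-LIT» ∕ h413 (`stmt-HodgeConjecture-24833`),
line «SC′-IRR-lev» (leaf (S-C′-irr) `sig_K2E3GL3TwoBlockInducedIrreducible`; lead K2E3-p24, dealer D82), brick JM-A part 1 (boxes in `N'` and the shear).  2026-09-04.
-/
import Summits.HodgeConjecture.HodgeConjecture.Theorems.K2E3GL3MaximalParabolicRelabel   -- K0 (this seat): `P₍₂,₁₎` of `GL₃` in the labelling `![0,0,1]`, root groups, chart decomposition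
import Literature.NumberTheory.Automorphic.CartanDecompositionGLnPowers                   -- ★ `exists_pow_mul_mem`
import HarnessLib

/-!
# K2_E3 road (h413), line «SC′-IRR-lev», brick JM-A part 1 — compact open boxes in `N' ≅ F²` and the shear `x₁₂(y) · Φ_{K,w} = Φ_{K, σ'(x₁₀ y) w}` on the standard
# sections of `Ind_{P₍₂,₁₎}^{GL₃} σ'`

Cell `pub/hodgecm-mathlib` (D-0151), Track B, seat K2E3-p24 (g2) = LEAD of line «SC′-IRR-lev».  `--supports stmt-HodgeConjecture-24833 --as helper`; THEOREMS ONLY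
(no definition ∕ instance ∕ notation ∕ named fact ∕ `sorry`); never imports `Cruxes/…/Lines`.  COUNT-NEUTRAL.

THE MATHEMATICS ([BernsteinZelevinsky1977, §5 (proof of Thm. 5.2 = Geometrical Lemma 2.12), §6]).  `P = P₍₂,₁₎ = standardParabolicGL F ![0,0,1] ≤ GL₃(F)`, `U = U_Q` its
unipotent radical (root groups `(0,2)`, `(1,2)`), `N' = oppositeCellRadical ![0,0,1] = U_{P₍₁,₂₎}` (root groups `(0,1)`, `(0,2)`; an abelian group `≅ F²`, every element is
`x₀₁(a) x₀₂(b)`), `σ'` a smooth representation of `P` on `W`, `Φ_{K,w} ∈ Ind_P^{GL₃} σ'` the standard section of the open cell `P w₀ N'` attached to a compact open `K ≤ N'`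
and `w ∈ W` (★ `cellSection`: `p w₀ n' ↦ 1_K(n') σ'(p) w`).
* §1 `exists_box`: the BOX `K(γ₁,γ₂) = {n' : v(n'₀₁) ≤ γ₁, v(n'₀₂) ≤ γ₂}` (`0 < γ₁ ≤ γ₂ < 1`) is a compact open subgroup of `N'`; `exists_gauge`: inside any open
  `K ≤ N'` there are boxes with `v(y) γ₁ ≤ γ₂` for any prescribed finite set of scalars `y`.
* §2 THE SHEAR: `x₁₂(y) ∈ U_Q ∩ P'` conjugates `x₀₁(a) x₀₂(b) ↦ x₀₁(a) x₀₂(b ∓ a y)` (K0), hence normalises every box with `v(y) γ₁ ≤ γ₂`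
  (`conjSubgroup_transvectionUnit_one_two_eq`), and `w₀ x₁₂(y) w₀⁻¹ = x₁₀(y)` (K0); so ★ `smoothIndRep_cellSection_of_conj_mem` gives
  **`smoothIndRep_transvectionUnit_one_two_cellSection`: `x₁₂(y) · Φ_{K,w} = Φ_{K, σ'(x₁₀ y) w}`** — right translation by the root group `(1,2)` of `U_Q` acts on the
  open-cell sections through the LOWER root group `(1,0)` of the `GL₂` block of the Levi.  Part 2 (`K2E3GL3CuspidalBlockJacquetSame`) turns this into `r_Q(i_Q σ') ≅ σ'`.

HONEST LABEL: HC_CM is proved only modulo the 7 printed citations (2 remaining named inputs: hLiu418 = stmt-HodgeConjecture-24832, h413 = stmt-HodgeConjecture-24833)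
until rung 0 closes; count-neutral helper.

## Mathlib ∕ tree search
Tree (★, by name): `cellSection`, `cellSection_congr`, `smoothIndRep_cellSection_of_conj_mem`, `conjSubgroup`, `mem_conjSubgroup_iff`, `coe_radicalConj_symm`,
`exists_congruenceGL_subset_of_isOpen`, `congruenceGL_mono`, `Zelevinsky1980.mem_congruenceGL_iff_of_mem_oppositeCellRadical`, `isCompact_congruenceGL`, `isClosed_oppositeCellRadical`,
`DeltaCharBorel.isOpen_setOf_valuation_le`, `isClosed_setOf_valuation_le`, `exists_pow_mul_mem`, `exists_isUniformizingElement`; K0.  Dedup: `rg "CuspidalBlockBoxes|exists_gauge"` — none.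

## References
* [BernsteinZelevinsky1977] I. N. Bernstein, A. V. Zelevinsky, *Induced representations of reductive 𝔭-adic groups I*, Ann. Sci. ÉNS 10 (1977), 2.12, §5 (Thm. 5.2), §6.
-/

set_option autoImplicit false
set_option linter.dupNamespace false

noncomputable section

open Matrix OrderDual

namespace Summit.HodgeConjecture.HodgeConjecture.Cruxes.H413.K2E3GL3CuspidalBlockBoxes

open Literature.NumberTheory.Automorphic K2E3GL3MaximalParabolicRelabel
open ValuativeRel

variable {F : Type*} [Field F] [ValuativeRel F] [TopologicalSpace F] [IsNonarchimedeanLocalField F]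
  {W : Type*} [AddCommGroup W] [Module ℂ W]
  (σ' : Representation ℂ ↥(standardParabolicGL F (![0, 0, 1] : Fin 3 → Fin 2)) W)

/-! ## §1  Boxes in `N' ≅ F²` -/

section Boxes

omit [ValuativeRel F] [TopologicalSpace F] [IsNonarchimedeanLocalField F] in
/-- Entries of `x₀₁(a) · x₀₂(b) ∈ N'`: `(0,1) ↦ a`, `(0,2) ↦ b`. [cite: BernsteinZelevinsky1977, §6] -/
theorem transvectionUnit_mul_apply_zero (a b : F) :
    ((transvectionUnit 0 1 (by decide) a * transvectionUnit 0 2 (by decide) b : GL (Fin 3) F) : Matrix (Fin 3) (Fin 3) F) 0 1 = a ∧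
      ((transvectionUnit 0 1 (by decide) a * transvectionUnit 0 2 (by decide) b : GL (Fin 3) F) : Matrix (Fin 3) (Fin 3) F) 0 2 = b := by
  have h1 := transvectionUnit_zero_one_mem_oppositeCellRadical (F := F) a
  have h2 := transvectionUnit_zero_two_mem_oppositeCellRadical (F := F) b
  refine ⟨?_, ?_⟩
  · rw [mul_apply_zero_of_mem_oppositeCellRadical h1 h2 (by decide), transvectionUnit_apply, transvectionUnit_apply]; simp
  · rw [mul_apply_zero_of_mem_oppositeCellRadical h1 h2 (by decide), transvectionUnit_apply, transvectionUnit_apply]; simp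

omit [ValuativeRel F] [TopologicalSpace F] [IsNonarchimedeanLocalField F] in
/-- First row of the inverse in `N'`: `(x⁻¹)₀ⱼ = -x₀ⱼ` (`j ≠ 0`). [cite: BernsteinZelevinsky1977, §6] -/
theorem inv_apply_zero_of_mem_oppositeCellRadical {x : GL (Fin 3) F} (hx : x ∈ oppositeCellRadical (K := F) (![0, 0, 1] : Fin 3 → Fin 2))
    {j : Fin 3} (hj : j ≠ 0) :
    ((x⁻¹ : GL (Fin 3) F) : Matrix (Fin 3) (Fin 3) F) 0 j = -(x : Matrix (Fin 3) (Fin 3) F) 0 j := by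
  have h := mul_apply_zero_of_mem_oppositeCellRadical (Subgroup.inv_mem _ hx) hx hj
  rw [inv_mul_cancel, Units.val_one, Matrix.one_apply_ne (Ne.symm hj)] at h
  exact eq_neg_of_add_eq_zero_left h.symm

/-- **The box `K(γ₁, γ₂) = {n' ∈ N' : v(n'₀₁) ≤ γ₁, v(n'₀₂) ≤ γ₂}`** for `0 < γ₁ ≤ γ₂ < 1` is a compact open subgroup of `N'` (theorem-level data: the subgroup is
produced, not named). [cite: BernsteinZelevinsky1977, §5 (proof of Thm. 5.2)] -/
theorem exists_box {γ₁ γ₂ : ValueGroupWithZero F} (h₁ : γ₁ ≠ 0) (h₁₂ : γ₁ ≤ γ₂) (h₂ : γ₂ < 1) :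
    ∃ K : Subgroup ↥(oppositeCellRadical (K := F) (![0, 0, 1] : Fin 3 → Fin 2)),
      IsOpen (K : Set ↥(oppositeCellRadical (K := F) (![0, 0, 1] : Fin 3 → Fin 2))) ∧
      IsCompact (K : Set ↥(oppositeCellRadical (K := F) (![0, 0, 1] : Fin 3 → Fin 2))) ∧
      ∀ x : ↥(oppositeCellRadical (K := F) (![0, 0, 1] : Fin 3 → Fin 2)), x ∈ K ↔
        valuation F (((x : GL (Fin 3) F) : Matrix (Fin 3) (Fin 3) F) 0 1) ≤ γ₁ ∧ valuation F (((x : GL (Fin 3) F) : Matrix (Fin 3) (Fin 3) F) 0 2) ≤ γ₂ := by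
  have h₂0 : γ₂ ≠ 0 := fun h => h₁ (le_antisymm (h ▸ h₁₂) zero_le)
  let K : Subgroup ↥(oppositeCellRadical (K := F) (![0, 0, 1] : Fin 3 → Fin 2)) :=
    { carrier := {x | valuation F (((x : GL (Fin 3) F) : Matrix (Fin 3) (Fin 3) F) 0 1) ≤ γ₁ ∧
        valuation F (((x : GL (Fin 3) F) : Matrix (Fin 3) (Fin 3) F) 0 2) ≤ γ₂}
      mul_mem' := by
        rintro x y ⟨hx1, hx2⟩ ⟨hy1, hy2⟩
        refine ⟨?_, ?_⟩
        · rw [Subgroup.coe_mul, mul_apply_zero_of_mem_oppositeCellRadical x.2 y.2 (by decide)]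
          exact (Valuation.map_add _ _ _).trans (max_le hx1 hy1)
        · rw [Subgroup.coe_mul, mul_apply_zero_of_mem_oppositeCellRadical x.2 y.2 (by decide)]
          exact (Valuation.map_add _ _ _).trans (max_le hx2 hy2)
      one_mem' := by
        refine ⟨?_, ?_⟩ <;> (rw [Subgroup.coe_one, Units.val_one, Matrix.one_apply_ne (by decide), map_zero]; exact zero_le)
      inv_mem' := by
        rintro x ⟨hx1, hx2⟩
        refine ⟨?_, ?_⟩
        · rw [Subgroup.coe_inv, inv_apply_zero_of_mem_oppositeCellRadical x.2 (by decide), Valuation.map_neg]; exact hx1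
        · rw [Subgroup.coe_inv, inv_apply_zero_of_mem_oppositeCellRadical x.2 (by decide), Valuation.map_neg]; exact hx2 }
  have hentry : ∀ i j : Fin 3, Continuous fun x : ↥(oppositeCellRadical (K := F) (![0, 0, 1] : Fin 3 → Fin 2)) =>
      ((x : GL (Fin 3) F) : Matrix (Fin 3) (Fin 3) F) i j :=
    fun i j => (Units.continuous_val.matrix_elem i j).comp continuous_subtype_val
  have hKset : (K : Set ↥(oppositeCellRadical (K := F) (![0, 0, 1] : Fin 3 → Fin 2))) =
      (fun x : ↥(oppositeCellRadical (K := F) (![0, 0, 1] : Fin 3 → Fin 2)) => ((x : GL (Fin 3) F) : Matrix (Fin 3) (Fin 3) F) 0 1) ⁻¹' {a | valuation F a ≤ γ₁} ∩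
        (fun x : ↥(oppositeCellRadical (K := F) (![0, 0, 1] : Fin 3 → Fin 2)) => ((x : GL (Fin 3) F) : Matrix (Fin 3) (Fin 3) F) 0 2) ⁻¹' {a | valuation F a ≤ γ₂} := rfl
  have hKo : IsOpen (K : Set ↥(oppositeCellRadical (K := F) (![0, 0, 1] : Fin 3 → Fin 2))) := by
    rw [hKset]
    exact ((DeltaCharBorel.isOpen_setOf_valuation_le h₁).preimage (hentry 0 1)).inter
      ((DeltaCharBorel.isOpen_setOf_valuation_le h₂0).preimage (hentry 0 2))
  have hKcl : IsClosed (K : Set ↥(oppositeCellRadical (K := F) (![0, 0, 1] : Fin 3 → Fin 2))) := by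
    rw [hKset]
    exact ((isClosed_setOf_valuation_le γ₁).preimage (hentry 0 1)).inter ((isClosed_setOf_valuation_le γ₂).preimage (hentry 0 2))
  -- `K ⊆ N' ∩ K_{γ₂}`, which is compact
  have hsub : (K : Set ↥(oppositeCellRadical (K := F) (![0, 0, 1] : Fin 3 → Fin 2))) ⊆
      (Subtype.val : ↥(oppositeCellRadical (K := F) (![0, 0, 1] : Fin 3 → Fin 2)) → GL (Fin 3) F) ⁻¹' (congruenceGL 3 γ₂ : Set (GL (Fin 3) F)) := by
    rintro x ⟨hx1, hx2⟩
    have hx' : (x : GL (Fin 3) F) ∈ oppositeCellRadical (K := F) (Zelevinsky1980.lastBlockLabel 3) := by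
      rw [← oppositeCellRadical_eq_lastBlockLabel]; exact x.2
    refine (Zelevinsky1980.mem_congruenceGL_iff_of_mem_oppositeCellRadical (n := 1) h₂ hx').2 fun j hj => ?_
    fin_cases j
    · exact absurd rfl hj
    · exact hx1.trans h₁₂
    · exact hx2
  have hKc : IsCompact (K : Set ↥(oppositeCellRadical (K := F) (![0, 0, 1] : Fin 3 → Fin 2))) :=
    ((isClosed_oppositeCellRadical (c := (![0, 0, 1] : Fin 3 → Fin 2))).isClosedEmbedding_subtypeVal.isCompact_preimage
      (isCompact_congruenceGL γ₂)).of_isClosed_subset hKcl hsub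
  exact ⟨K, hKo, hKc, fun x => Iff.rfl⟩

/-- **Small boxes inside an open subgroup of `N'`, adapted to finitely many scalars**: for `K ≤ N'` open and a finite set `ys ⊆ F` there are `0 < γ₁ ≤ γ₂ < 1` with
`v(y) γ₁ ≤ γ₂` for `y ∈ ys` and `K(γ₁, γ₂) ⊆ K`. [cite: BernsteinZelevinsky1977, §5 (proof of Thm. 5.2)] -/
theorem exists_gauge (K : Subgroup ↥(oppositeCellRadical (K := F) (![0, 0, 1] : Fin 3 → Fin 2)))
    (hKo : IsOpen (K : Set ↥(oppositeCellRadical (K := F) (![0, 0, 1] : Fin 3 → Fin 2)))) (ys : Finset F) :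
    ∃ γ₁ γ₂ : ValueGroupWithZero F, γ₁ ≠ 0 ∧ γ₁ ≤ γ₂ ∧ γ₂ < 1 ∧ (∀ y ∈ ys, valuation F y * γ₁ ≤ γ₂) ∧
      ∀ x : ↥(oppositeCellRadical (K := F) (![0, 0, 1] : Fin 3 → Fin 2)),
        valuation F (((x : GL (Fin 3) F) : Matrix (Fin 3) (Fin 3) F) 0 1) ≤ γ₁ →
        valuation F (((x : GL (Fin 3) F) : Matrix (Fin 3) (Fin 3) F) 0 2) ≤ γ₂ → x ∈ K := by
  classical
  obtain ⟨γ, hγ⟩ := exists_congruenceGL_subset_of_isOpen hKo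
  obtain ⟨ϖ, hϖ⟩ := exists_isUniformizingElement (F := F)
  have hvϖ0 : valuation F ϖ ≠ 0 := (Valuation.ne_zero_iff _).mpr hϖ.ne_zero
  -- `γ₂ := min γ (v ϖ) < 1`
  set γ₂ : ValueGroupWithZero F := min (γ : ValueGroupWithZero F) (valuation F ϖ) with hγ₂
  have hγ₂1 : γ₂ < 1 := (min_le_right _ _).trans_lt hϖ.valuation_lt_one
  have hγ₂0 : γ₂ ≠ 0 := by
    rcases min_choice (γ : ValueGroupWithZero F) (valuation F ϖ) with h | h
    · rw [hγ₂, h]; exact γ.ne_zero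
    · rw [hγ₂, h]; exact hvϖ0
  have hγ₂γ : γ₂ ≤ (γ : ValueGroupWithZero F) := min_le_left _ _
  -- a common power `ϖ^N` making every `y ∈ ys` integral
  choose N hN using fun y : F => exists_pow_mul_mem hϖ y
  set N₀ : ℕ := ys.sup N with hN₀
  have hint : ∀ y ∈ ys, valuation F (ϖ ^ N₀ * y) ≤ 1 := fun y hy =>
    (Valuation.mem_integer_iff _ _).1 (hN y N₀ (Finset.le_sup hy))
  refine ⟨γ₂ * valuation F ϖ ^ N₀, γ₂, mul_ne_zero hγ₂0 (pow_ne_zero _ hvϖ0), ?_, hγ₂1, fun y hy => ?_, fun x hx1 hx2 => ?_⟩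
  · exact mul_le_of_le_one_right' (pow_le_one₀ zero_le hϖ.valuation_le_one)
  · calc valuation F y * (γ₂ * valuation F ϖ ^ N₀) = valuation F (ϖ ^ N₀ * y) * γ₂ := by rw [map_mul, map_pow]; ac_rfl
      _ ≤ 1 * γ₂ := mul_le_mul' (hint y hy) le_rfl
      _ = γ₂ := one_mul _
  · have hx' : (x : GL (Fin 3) F) ∈ oppositeCellRadical (K := F) (Zelevinsky1980.lastBlockLabel 3) := by
      rw [← oppositeCellRadical_eq_lastBlockLabel]; exact x.2
    refine hγ x (congruenceGL_mono hγ₂γ ((Zelevinsky1980.mem_congruenceGL_iff_of_mem_oppositeCellRadical (n := 1) hγ₂1 hx').2 fun j hj => ?_))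
    fin_cases j
    · exact absurd rfl hj
    · exact hx1.trans (mul_le_of_le_one_right' (pow_le_one₀ zero_le hϖ.valuation_le_one))
    · exact hx2

end Boxes

/-! ## §2  The shear `x₁₂(y)` and the standard sections `Φ_{K,w}` -/

section Shear

omit [TopologicalSpace F] [IsNonarchimedeanLocalField F] in
/-- **A box with `v(y) γ₁ ≤ γ₂` is normalised by `x₁₂(y)`**: `x₁₂(y) K(γ₁,γ₂) x₁₂(y)⁻¹ = K(γ₁,γ₂)` (the shear `(a, b) ↦ (a, b ∓ a y)` of `N' ≅ F²` preserves it).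
[cite: BernsteinZelevinsky1977, §5 (proof of Thm. 5.2)] -/
theorem conjSubgroup_transvectionUnit_one_two_eq {γ₁ γ₂ : ValueGroupWithZero F} {y : F} (hy : valuation F y * γ₁ ≤ γ₂)
    (K : Subgroup ↥(oppositeCellRadical (K := F) (![0, 0, 1] : Fin 3 → Fin 2)))
    (hK : ∀ x : ↥(oppositeCellRadical (K := F) (![0, 0, 1] : Fin 3 → Fin 2)), x ∈ K ↔
      valuation F (((x : GL (Fin 3) F) : Matrix (Fin 3) (Fin 3) F) 0 1) ≤ γ₁ ∧ valuation F (((x : GL (Fin 3) F) : Matrix (Fin 3) (Fin 3) F) 0 2) ≤ γ₂) :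
    conjSubgroup (transvectionUnit_one_two_mem_reversedParabolic (F := F) y) K = K := by
  ext x
  rw [mem_conjSubgroup_iff, hK, hK]
  -- coordinates of `x` and of `x₁₂(y)⁻¹ x x₁₂(y)`
  set a : F := ((x : GL (Fin 3) F) : Matrix (Fin 3) (Fin 3) F) 0 1 with ha
  set b : F := ((x : GL (Fin 3) F) : Matrix (Fin 3) (Fin 3) F) 0 2 with hb
  have hx : (x : GL (Fin 3) F) = transvectionUnit 0 1 (by decide) a * transvectionUnit 0 2 (by decide) b :=
    eq_transvectionUnit_mul_of_mem_oppositeCellRadical x.2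
  have hconj : (transvectionUnit 1 2 (by decide) y : GL (Fin 3) F)⁻¹ * (x : GL (Fin 3) F) * transvectionUnit 1 2 (by decide) y =
      transvectionUnit 0 1 (by decide) a * transvectionUnit 0 2 (by decide) (b + a * y) := by
    have h := transvectionUnit_one_two_conj (F := F) y a (b + a * y)
    rw [add_sub_cancel_right, ← hx] at h
    rw [← h]; group
  have hcoe : ((((radicalConj (transvectionUnit_one_two_mem_reversedParabolic (F := F) y)).symm x :
      ↥(oppositeCellRadical (K := F) (![0, 0, 1] : Fin 3 → Fin 2))) : GL (Fin 3) F) : Matrix (Fin 3) (Fin 3) F) =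
      ((transvectionUnit 0 1 (by decide) a * transvectionUnit 0 2 (by decide) (b + a * y) : GL (Fin 3) F) : Matrix (Fin 3) (Fin 3) F) := by
    rw [coe_radicalConj_symm, hconj]
  obtain ⟨e1, e2⟩ := transvectionUnit_mul_apply_zero (F := F) a (b + a * y)
  rw [hcoe, e1, e2]
  refine and_congr_right fun ha1 => ?_
  have hay : valuation F (a * y) ≤ γ₂ := by
    rw [map_mul, mul_comm]; exact (mul_le_mul' le_rfl ha1).trans hy
  constructor
  · intro h
    have : b = (b + a * y) - a * y := by ring
    rw [this]
    exact (Valuation.map_sub _ _ _).trans (max_le h hay)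
  · intro h
    exact (Valuation.map_add _ _ _).trans (max_le h hay)

/-- **THE SHEAR ON STANDARD SECTIONS**: for a box `K` with `v(y) γ₁ ≤ γ₂`, `x₁₂(y) · Φ_{K,w} = Φ_{K, σ'(x₁₀ y) w}` — right translation by the root group
`(1,2) ⊂ U_Q` acts on the open-cell sections through the LOWER root group `(1,0)` of the `GL₂` block (★ `smoothIndRep_cellSection_of_conj_mem` with
`w₀ x₁₂(y) w₀⁻¹ = x₁₀(y)`). [cite: BernsteinZelevinsky1977, Thm. 5.2] -/
theorem smoothIndRep_transvectionUnit_one_two_cellSection (hσ' : σ'.IsSmooth) {γ₁ γ₂ : ValueGroupWithZero F} {y : F} (hy : valuation F y * γ₁ ≤ γ₂)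
    (K : Subgroup ↥(oppositeCellRadical (K := F) (![0, 0, 1] : Fin 3 → Fin 2)))
    (hKo : IsOpen (K : Set ↥(oppositeCellRadical (K := F) (![0, 0, 1] : Fin 3 → Fin 2))))
    (hKc : IsCompact (K : Set ↥(oppositeCellRadical (K := F) (![0, 0, 1] : Fin 3 → Fin 2))))
    (hK : ∀ x : ↥(oppositeCellRadical (K := F) (![0, 0, 1] : Fin 3 → Fin 2)), x ∈ K ↔
      valuation F (((x : GL (Fin 3) F) : Matrix (Fin 3) (Fin 3) F) 0 1) ≤ γ₁ ∧ valuation F (((x : GL (Fin 3) F) : Matrix (Fin 3) (Fin 3) F) 0 2) ≤ γ₂) (w : W) :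
    Representation.smoothIndRep (standardParabolicGL F (![0, 0, 1] : Fin 3 → Fin 2)) σ' (transvectionUnit 1 2 (by decide) y)
        (cellSection σ' monotone_twoOne hσ' K hKo hKc w) =
      cellSection σ' monotone_twoOne hσ' K hKo hKc (σ' ⟨transvectionUnit 1 0 (by decide) y, transvectionUnit_one_zero_mem_standardParabolicGL y⟩ w) := by
  have hmP : (permGL Fin.revPerm : GL (Fin 3) F) * transvectionUnit 1 2 (by decide) y * (permGL Fin.revPerm)⁻¹ ∈
      standardParabolicGL F (![0, 0, 1] : Fin 3 → Fin 2) := by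
    rw [permGL_rev_mul_transvectionUnit_one_two_mul_inv]; exact transvectionUnit_one_zero_mem_standardParabolicGL y
  rw [smoothIndRep_cellSection_of_conj_mem σ' monotone_twoOne hσ' K hKo hKc w (transvectionUnit_one_two_mem_reversedParabolic (F := F) y) hmP,
    cellSection_congr monotone_twoOne hσ' (conjSubgroup_transvectionUnit_one_two_eq hy K hK) _ _ hKo hKc]
  have hsub : (⟨(permGL Fin.revPerm : GL (Fin 3) F) * transvectionUnit 1 2 (by decide) y * (permGL Fin.revPerm)⁻¹, hmP⟩ :
      ↥(standardParabolicGL F (![0, 0, 1] : Fin 3 → Fin 2))) = ⟨transvectionUnit 1 0 (by decide) y, transvectionUnit_one_zero_mem_standardParabolicGL y⟩ :=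
    Subtype.ext (permGL_rev_mul_transvectionUnit_one_two_mul_inv y)
  rw [hsub]

end Shear

end Summit.HodgeConjecture.HodgeConjecture.Cruxes.H413.K2E3GL3CuspidalBlockBoxes

end
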